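import Summits.QuantumFields.YangMills.Theorems.AllWindowsColdBoxBoxHighLineOrbitMapBulkSurj
import Summits.QuantumFields.YangMills.Theorems.AllWindowsColdBoxBoxHighLineOrbitMapContractionSup

/-!
# J4∞ «`OrbitMapBulkSurj` in the sup norm»: the orbit map is onto the SUP ball `max_j |c_j| ≤ ρ` from the sup-box `‖(♭⁻¹v)_x‖ ≤ a`,
# in the regime `C·(r₀ + a)·H² ≤ 1`, `C·H²·ρ ≤ a` — no `H⁴·a ≤ 1`, no logarithm

Width seat `ym-line-sfw-p2-w2` (prover-ym-line-sfw-p2-w2-g32-0), free hands for planner ym-idea-2 g18's recorded lift **L1** of blocker **B1** of the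
next rung U5 (`Cruxes/BoxWindowHighSU2213/U5-BLOCKERS.md` §1–§2: «redo J2 `OrbitMapContraction` and J4 `OrbitMapBulkSurj` in `ℓ^∞` instead of `ℓ²`»).
This is the SECOND brick (J4∞), w4's ✓J4 (`…OrbitMapBulkSurj`, `orbitMapBulkSurj_of`) re-run with the sup norm throughout:

* `OrbitMapSup.lipschitzOnWith_newton_sup` — the Newton map `T_c v = v − G(Ψ v − c)` is `K`-Lipschitz on a convex set in Mathlib's sup norm on
  `ι → ℝ` as soon as `‖w − G(Ψ'(v) w)‖ ≤ K₀‖w‖` there (`K₀ ≤ K`; mean value inequality — w4's `lipschitzOnWith_newton` minus the `√|ι|` conversion);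
* ★★ **`OrbitMapSup.orbitMap_bulkSurj_sup`** — `∃ C > 0, ∀ H ≥ 1, ∀ r₀ a ρ ≥ 0, C·(r₀ + a)·H² ≤ 1 → C·H²·ρ ≤ a → ∀ V Landau (links within defect r₀²),
  ∀ c (|c_j| ≤ ρ ∀ j), ∃ v (‖(♭⁻¹v)_x‖ ≤ a ∀ x), orbitMapFlat H V v = c`.
  Banach fixed point of `T_c` on the closed convex block box (w4's ✓`isClosed_blockBox`/`convex_blockBox`/`exists_apply_eq_of_lipschitzOnWith`):
  sup-Lipschitz constant `C_J·H²·a ≤ 1/4` by ✓J2∞ `OrbitMapSup.norm_sub_inv_mulVec_fderiv_le` (NO `√|ι| ≍ 7H²` loss, hence no `H⁴·a ≤ 1`);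
  self-map `‖(T_c v)_x‖ ≤ √3·¼·‖v‖_∞ + ‖(F_V⁻¹c)_x‖ ≤ (√3/4)·a + 2·C_F·H²·ρ ≤ a` by the `ℓ^∞ → ℓ^∞` bound ✓`OrbitMapSup.abs_fpOperator_inv_mulVec_le`
  (`C·H²`, NO `(1 + log H)²`); differentiability from ✓J1 `OrbitChart.hasFDerivAt_orbitMapFlat_matrix`; `Ψ_V(0) = 0` from ✓`orbitMapFlat_zero`.

Compared with ✓J4 (`C·(r₀ + a)·H² ≤ 1`, `C·H⁴·a ≤ 1`, `C·(1 + log H)²·ρ ≤ a`, ℓ²-ball `|c|₂ ≤ ρ`): the Gaussian `dc·e^{−β|c|²/2}` of the Laplace step lives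
at SUP radius `ρ ≍ β^{-1/2}·polylog` (not at ℓ²-radius `H²β^{-1/2}`), so with `a = C·H²·ρ` the contraction condition `C·a·H² ≤ 1` reads
`H⁴·β^{-1/2}·polylog ≪ 1`, i.e. the window **`8θ < 1`** of the memo's L1 (instead of B1's `12θ < 1`).  The downstream Laplace/Jacobian assembly
(J0/J3/J5, `OrbitNormaliserJacobianR`) is NOT redone here.

Everything proved; no definitions; Mathlib + tree only; standard axioms.  HONEST LABEL: a glue brick for the recorded lift L1 of the NEXT rung U5
(LINE-20 ⟨stmt-QuantumFields-24336⟩, unstaffed, gated by the critic's N2/I23); lifts L2–L5 and the re-assembly of T-S5.4J in `ℓ^∞` are not here;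
S5, U5, ⟨24004⟩ ⟨24335⟩ ⟨24336⟩ remain OPEN; no stub is closed by name; no crux, rung or summit is proved; **the Yang–Mills mass gap is NOT proved by
this file; no summit is proved by a line.**
-/

set_option autoImplicit false

open Matrix Finset Set
open scoped NNReal
open Literature.MathematicalPhysics.QuantumFieldTheory.AxialGauge (boxEdges)
open Literature.MathematicalPhysics.QuantumLattice (gaugeTransformZd LGConfig)
open Literature.Probability.LatticeModels (Site)

namespace Summit.QuantumFields.YangMills.Theorems.AllWindowsColdBoxBoxHighLine

namespace OrbitMapSup

/-! ## 1. The Newton–contraction engine in the sup norm -/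

section Engine

variable {ι : Type*} [Fintype ι] [DecidableEq ι]

/-- **Sup-Lipschitz bound of the Newton map** `T_c v = v − G(Ψ v − c)` on a convex set `S`: from `HasFDerivAt Ψ (Ψ' v) v` on `S` and the SUP-norm
bound `‖w − G(Ψ' v w)‖ ≤ K₀‖w‖` (the shape of J2∞), `T_c` is `K`-Lipschitz on `S` for any `K ≥ K₀` (mean value inequality). -/
theorem lipschitzOnWith_newton_sup (Ψ : (ι → ℝ) → (ι → ℝ)) (Ψ' : (ι → ℝ) → ((ι → ℝ) →L[ℝ] (ι → ℝ))) (G : Matrix ι ι ℝ)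
    (S : Set (ι → ℝ)) (hSconv : Convex ℝ S) (hdiff : ∀ v ∈ S, HasFDerivAt Ψ (Ψ' v) v)
    {K₀ : ℝ} (hK₀ : 0 ≤ K₀) (hcontr : ∀ v ∈ S, ∀ w, ‖w - G *ᵥ (Ψ' v w)‖ ≤ K₀ * ‖w‖)
    (K : ℝ≥0) (hK : K₀ ≤ K) (c : ι → ℝ) :
    LipschitzOnWith K (fun v => v - G *ᵥ (Ψ v - c)) S := by
  set Gop : (ι → ℝ) →L[ℝ] (ι → ℝ) := LinearMap.toContinuousLinearMap (Matrix.toLin' G) with hGop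
  have hGop_apply : ∀ w, Gop w = G *ᵥ w := fun w => by
    rw [hGop, LinearMap.coe_toContinuousLinearMap', Matrix.toLin'_apply]
  -- the derivative of `T_c` within `S`
  have hT : ∀ v ∈ S, HasFDerivWithinAt (fun v => v - G *ᵥ (Ψ v - c))
      (ContinuousLinearMap.id ℝ (ι → ℝ) - Gop.comp (Ψ' v)) S v := by
    intro v hv
    have h1 : HasFDerivAt (fun v => Ψ v - c) (Ψ' v) v := (hdiff v hv).sub_const c
    have h2 : HasFDerivAt (fun v => Gop (Ψ v - c)) (Gop.comp (Ψ' v)) v := Gop.hasFDerivAt.comp v h1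
    have h3 : HasFDerivAt (fun v => G *ᵥ (Ψ v - c)) (Gop.comp (Ψ' v)) v := by
      refine h2.congr_of_eventuallyEq (Filter.Eventually.of_forall fun w => ?_)
      simp only [hGop_apply]
    exact ((hasFDerivAt_id v).sub h3).hasFDerivWithinAt
  -- its operator norm
  have hbound : ∀ v ∈ S, ‖ContinuousLinearMap.id ℝ (ι → ℝ) - Gop.comp (Ψ' v)‖₊ ≤ K := by
    intro v hv
    have h : ‖ContinuousLinearMap.id ℝ (ι → ℝ) - Gop.comp (Ψ' v)‖ ≤ K₀ := by
      refine ContinuousLinearMap.opNorm_le_bound _ hK₀ fun w => ?_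
      have hw : (ContinuousLinearMap.id ℝ (ι → ℝ) - Gop.comp (Ψ' v)) w = w - G *ᵥ (Ψ' v w) := by
        simp only [_root_.sub_apply, ContinuousLinearMap.id_apply, ContinuousLinearMap.comp_apply, hGop_apply]
      rw [hw]
      exact hcontr v hv w
    exact_mod_cast h.trans hK
  exact hSconv.lipschitzOnWith_of_nnnorm_hasFDerivWithin_le hT hbound

end Engine

/-! ## 2. J4∞ -/

/-- `√3 ≤ 2`. -/
theorem sqrt_three_le_two : Real.sqrt 3 ≤ 2 := by
  rw [show (2 : ℝ) = Real.sqrt (2 ^ 2) by rw [Real.sqrt_sq (by norm_num : (0:ℝ) ≤ 2)]]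
  exact Real.sqrt_le_sqrt (by norm_num)

open OrbitMapSurj in
/-- ★★ **J4∞ — `OrbitMapBulkSurj` in the sup norm.**  One constant `C > 0`: for `H ≥ 1`, `r₀, a, ρ ≥ 0` with `C·(r₀ + a)·H² ≤ 1` and `C·H²·ρ ≤ a`,
every lattice-Landau configuration `V` with cold-box links within defect `r₀²`, and every `c` in the SUP ball `|c_j| ≤ ρ`, there is `v` in the block
box `‖(♭⁻¹v)_x‖ ≤ a` with `orbitMapFlat H V v = c`.  (Banach fixed point of `T_c v = v − F_V⁻¹(Ψ_V v − c)` on the block box: sup-contraction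
`C_J H² a ≤ 1/4` by ✓J2∞, self-map `(√3/4)·a + 2·C_F·H²·ρ ≤ a` by the `ℓ^∞` row bound of `F_V⁻¹`.) -/
theorem orbitMap_bulkSurj_sup : ∃ C : ℝ, 0 < C ∧ ∀ H : ℕ, 1 ≤ H → ∀ r₀ a ρ : ℝ, 0 ≤ r₀ → 0 ≤ a → 0 ≤ ρ →
    C * (r₀ + a) * (H : ℝ) ^ 2 ≤ 1 → C * (H : ℝ) ^ 2 * ρ ≤ a →
    ∀ V : LGConfig 4 SU2, InLandauGauge H V → (∀ e ∈ boxEdges 4 (2 * H + 1), linkDefect V e ≤ r₀ ^ 2) →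
      ∀ c : ↥(interiorSites H) × Fin 3 → ℝ, (∀ j, |c j| ≤ ρ) →
        ∃ v : ↥(interiorSites H) × Fin 3 → ℝ, (∀ x, ‖vecToField H v x‖ ≤ a) ∧ orbitMapFlat H V v = c := by
  obtain ⟨C₂, hC₂, hJ2⟩ := norm_sub_inv_mulVec_fderiv_le
  obtain ⟨C_F, hCF, hF⟩ := abs_fpOperator_inv_mulVec_le
  refine ⟨4 * C₂ + 4 * C_F + 1, by positivity, ?_⟩
  intro H hH r₀ a ρ hr₀ ha hρ h1 h2 V hV hlinks c hc
  have hH' : (1 : ℝ) ≤ H := by exact_mod_cast hH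
  set C := 4 * C₂ + 4 * C_F + 1 with hCdef
  have hH2 : (1 : ℝ) ≤ (H : ℝ) ^ 2 := one_le_pow₀ hH'
  -- the regimes of J2∞ and of the row bound, `a ≤ 1`, the contraction constant `C₂ H² a ≤ 1/4`, and `4 C_F H² ρ ≤ a`
  have haH : 0 ≤ a * (H : ℝ) ^ 2 := by positivity
  have hrH : 0 ≤ r₀ * (H : ℝ) ^ 2 := by positivity
  have hr₀J2 : C₂ * r₀ * (H : ℝ) ^ 2 ≤ 1 := by nlinarith
  have hr₀F : C_F * r₀ * (H : ℝ) ^ 2 ≤ 1 := by nlinarith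
  have ha1 : a ≤ 1 := by nlinarith
  have hK₀ : C₂ * (H : ℝ) ^ 2 * a ≤ 1 / 4 := by nlinarith
  have hρa : 4 * C_F * (H : ℝ) ^ 2 * ρ ≤ a := by
    have : 4 * C_F * (H : ℝ) ^ 2 * ρ ≤ C * (H : ℝ) ^ 2 * ρ := by
      have h0 : 0 ≤ (H : ℝ) ^ 2 * ρ := by positivity
      nlinarith
    exact this.trans h2
  obtain ⟨hFunit, hJ2v⟩ := hJ2 H hH r₀ a hr₀ ha ha1 hr₀J2 V hlinks
  obtain ⟨-, hFc⟩ := hF H hH r₀ hr₀ hr₀F V hlinks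
  -- the set, the map, its Lipschitz bound
  set K : ℝ≥0 := 1 / 4 with hKdef
  have hK1 : K < 1 := by rw [hKdef]; norm_num
  set S : Set (↥(interiorSites H) × Fin 3 → ℝ) := {v | ∀ x, ‖vecToField H v x‖ ≤ a} with hSdef
  have hdiff : ∀ v ∈ S, HasFDerivAt (orbitMapFlat H V) (fderiv ℝ (orbitMapFlat H V) v) v :=
    fun v _ => (OrbitChart.hasFDerivAt_orbitMapFlat_matrix H V v).differentiableAt.hasFDerivAt
  have hcontr : ∀ v ∈ S, ∀ w, ‖w - (fpOperator H V)⁻¹ *ᵥ (fderiv ℝ (orbitMapFlat H V) v w)‖ ≤ C₂ * (H : ℝ) ^ 2 * a * ‖w‖ :=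
    fun v hv w => hJ2v v hv w
  have hLip := lipschitzOnWith_newton_sup (orbitMapFlat H V) (fun v => fderiv ℝ (orbitMapFlat H V) v) ((fpOperator H V)⁻¹) S
    (convex_blockBox a) hdiff (by positivity) hcontr K (by rw [hKdef]; exact_mod_cast hK₀) c
  -- the self-map
  have h0S : (0 : ↥(interiorSites H) × Fin 3 → ℝ) ∈ S := zero_mem_blockBox ha
  have hΨ0 : orbitMapFlat H V 0 = 0 := orbitMapFlat_zero V hV
  have hblockFc : ∀ x, ‖vecToField H ((fpOperator H V)⁻¹ *ᵥ c) x‖ ≤ 2 * (C_F * (H : ℝ) ^ 2 * ρ) :=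
    norm_vecToField_le_two_mul _ (fun j => hFc c ρ hc j)
  have hmaps : MapsTo (fun v => v - (fpOperator H V)⁻¹ *ᵥ (orbitMapFlat H V v - c)) S S := by
    intro v hv x
    show ‖vecToField H (v - (fpOperator H V)⁻¹ *ᵥ (orbitMapFlat H V v - c)) x‖ ≤ a
    have hT0 : (0 : ↥(interiorSites H) × Fin 3 → ℝ) - (fpOperator H V)⁻¹ *ᵥ (orbitMapFlat H V 0 - c) = (fpOperator H V)⁻¹ *ᵥ c := by
      rw [hΨ0, zero_sub, zero_sub, Matrix.mulVec_neg, neg_neg]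
    have hdist : ‖(v - (fpOperator H V)⁻¹ *ᵥ (orbitMapFlat H V v - c)) -
        ((0 : ↥(interiorSites H) × Fin 3 → ℝ) - (fpOperator H V)⁻¹ *ᵥ (orbitMapFlat H V 0 - c))‖ ≤ K * ‖v - 0‖ :=
      hLip.norm_sub_le hv h0S
    rw [sub_zero] at hdist
    have hsplit : v - (fpOperator H V)⁻¹ *ᵥ (orbitMapFlat H V v - c) =
        ((v - (fpOperator H V)⁻¹ *ᵥ (orbitMapFlat H V v - c)) -
          ((0 : ↥(interiorSites H) × Fin 3 → ℝ) - (fpOperator H V)⁻¹ *ᵥ (orbitMapFlat H V 0 - c))) + (fpOperator H V)⁻¹ *ᵥ c := by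
      rw [hT0, sub_add_cancel]
    rw [hsplit, vecToField_add, Pi.add_apply]
    have hv' : ‖v‖ ≤ a := norm_le_of_mem_blockBox ha hv
    have hA : ‖vecToField H ((v - (fpOperator H V)⁻¹ *ᵥ (orbitMapFlat H V v - c)) -
        ((0 : ↥(interiorSites H) × Fin 3 → ℝ) - (fpOperator H V)⁻¹ *ᵥ (orbitMapFlat H V 0 - c))) x‖ ≤ Real.sqrt 3 * ((1 / 4) * a) := by
      refine (norm_vecToField_le _ x).trans (mul_le_mul_of_nonneg_left ?_ (Real.sqrt_nonneg _))
      refine hdist.trans ?_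
      rw [hKdef]
      push_cast
      exact mul_le_mul_of_nonneg_left hv' (by norm_num)
    have hB := hblockFc x
    have hsum : Real.sqrt 3 * ((1 / 4) * a) + 2 * (C_F * (H : ℝ) ^ 2 * ρ) ≤ a := by
      nlinarith [sqrt_three_le_two, Real.sqrt_nonneg 3]
    exact (norm_add_le_of_le hA hB).trans hsum
  -- conclude
  exact exists_apply_eq_of_lipschitzOnWith (orbitMapFlat H V) (fpOperator H V) hFunit S (isClosed_blockBox a) h0S c hK1 hLip hmaps

end OrbitMapSup

end Summit.QuantumFields.YangMills.Theorems.AllWindowsColdBoxBoxHighLine
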